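import Literature.MathematicalPhysics.QuantumFieldTheory.Balaban1983to89.B9Ineq349SiteFromConv348

/-!
# `Balaban1983to89.B9Thm39ReadingFaithful` — T. Bałaban, *Propagators for lattice gauge theories in a background field*, Commun. Math. Phys. **99** (1985)
# 389–434 [Balaban1985BackgroundPropagators], Thm 3.9 ⇒ Thm 3.2 (rows 15–16 of the N06 knit) READ THROUGH THE FAITHFUL REPRESENTATIVE `repSite39F`:
# n06-j's `B9Thm39ReadingAtLetters` §4–§5 twinned on the block map `blk39F bI` (`B9Ineq349SiteFromConv348`), so that rows 15–16 and row 25 can share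
# ONE carrier pin whose majorant is block-complete

[4] = T. Bałaban, *Propagators and renormalization transformations for lattice gauge theories. II*, Commun. Math. Phys. **96** (1984) 223–250
[`Balaban1984PropagatorsII`].

statement-level skeleton of published theorems with citation tags; proofs where landed; nothing here is a claim about the Yang–Mills mass gap

THE PRINT.  p. 413, Theorem 3.9 (3.98)–(3.99) and *«This theorem implies Theorem 3.2»*; p. 398 (3.48); [4] p. 248 *«sites replaced by bonds»*, (2.45) p. 231.

WHY THIS FILE (dag-n06-i gen 11; rows 15–16 are n06-j's F5 — this is a TWIN of their §4–§5, not a replacement, offered so the knit can pin rows 15–16 and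
row 25 on the same faithful carrier).  n06-j's rows 15 ∧ 16 (`t39_hksum_of_pins_opsYOfLetters`) read the carrier through `repSite39 = rep39 ∘ β`, where
`rep39` is arbitrary at blocks outside the range of `β`; row 25's (3.48) input needs the carrier majorant at EVERY block (`B9Ineq349SiteFromConv348`).  The
faithful representative `rep39F bI` (right level, `d_T ≤ 1`, and `β ∘ rep ∘ β = β` — the only property the reading uses) supports the SAME reading: here are
the invariances of `repSite39F := rep39F ∘ β`, the reading `KerReadsLeVia` DISCHARGED for `blk39F` (through n06-i's arbitrary-block dictionary
`norm_CY_deltaY_le_of_inverse`, constant `cR39·|κ39|`), and rows 15 ∧ 16 at `opsYOfLetters` with the pins `(𝔬39 x).blk = blk39F … (bI x)`,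
`(𝔬39 x).L = L39 …`, `(ops x).EK39 = EK39OfOpsBlkVia … (repSite39F x.toKIdx (bI x))` — via n06-j's generic `t39_hksum_of_pin_rowConst261BlkViaDatum`.

WHAT IS PROVED (sorry-free; bookkeeping over landed objects).
* §1 `repSite39F`, ★ `beta_repSite39F` (hβI), `dist_repSite39F`, `dist_repSite39F_left`, `dist_repSite39F_right`, `lvl_repSite39F`, `len_repSite39F`,
  `vol_repSite39F`, `blk39F_beta`.
* §2 `abs_entry_le_blockKer` (an entry is at most the block norm of its fibres), ★★ `reading_le_of_letters_F` (n06-j's `reading_le_of_letters` for `blk39F`: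
  `|Cinv.ker U y y′| ≤ (cR39·|κ39|)·((L^{j′}η)^{d+1})⁻¹·blockKer (blk39F bI) T (πF y) (πF y′)`).
* §3 at the record's carriers: ★ `kerReadsLeVia_opsYOfLetters_F`, ★★ `t39_hksum_of_pins_opsYOfLetters_F` (rows 15 ∧ 16 with the faithful pins; one more
  displayed geometric binder `hβI` — the knit already displays it).

HONEST SCOPE.  As n06-j's file: every Theorem-3.9 schema stays a DISPLAYED hypothesis of printed shape; nothing of [B9] or [4] asserted; count-neutral; N06 NOT
discharged; nothing continuum ∕ OS ∕ mass gap.  Cell `pub-ymgap` (D-0062), node N06 [B9], seat `pub-ymgap-dag-n06-i` (gen 11), 2026-08-27; a NEW file.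
-/

noncomputable section

namespace Literature.MathematicalPhysics.QuantumFieldTheory.Balaban1983to89.B9Thm39ReadingFaithful

open Finset B9Thm34Inv B9Thm39Whole B9Thm39WholeBlk B9Thm39WholeBlkVia B9Thm39WholeBlkViaDatum B9Thm39ReadingCoords Node00
open B9Thm39ReadingAtLetters (κ39 basis39 X39 L39)
open B9Ineq349SiteFromConv348 (rep39F blk39F beta_rep39F_beta lvl_rep39F norm_CY_deltaY_le_of_inverse)
open B9Ineq349SiteComposite (lenB lenB_pos)
open B9Ineq349SiteFromBlocks (geo9Y_len_eq_lenB)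
open B6GlobalChartV1 (blkV1)
open B6Ineq2142KLevelV1 (lvl β beta_level)
open B6KLevelCensusIndexV1 (KIdx)
open B9GeoNormsKLevelV1 (geo9K geo9K_len_kGeo)
open B9PinMembersKLevelV1 (MemberY geo9Y bg9Y)

variable {𝔸 : Type} [NormedRing 𝔸] [NormedAlgebra ℂ 𝔸] [CompleteSpace 𝔸]
variable {d ℓ : ℕ} {hd : 1 ≤ d + 1} {hL : Odd (ℓ + 1) ∧ 1 < ℓ + 1} {b₀ b₁ : ℝ} {Mstar : ℕ}

/-! ## §1 The faithful representative map of the geometry of record and its invariances (from `β ∘ rep ∘ β = β`) -/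

section Rep

variable (i : KIdx d ℓ hd hL b₀ b₁) (bI : FBondY i → IBondY i)

/-- ★ **THE FAITHFUL REPRESENTATIVE MAP**: `πF c :=` the faithful representative bond of the carrier block of `c` (twin of n06-j's `repSite39`).
[cite: Balaban1984PropagatorsII, p.248 («sites replaced by bonds») + (2.45) p.231, dictionary] -/
def repSite39F (c : IBondY i) : IBondY i := rep39F i bI (β i.hN i.D i.hk c)

variable {i bI} (hβI : ∀ (f : FBondY i) (c : IBondY i), blkV1 i.hN i.D f = β i.hN i.D i.hk c → β i.hN i.D i.hk (bI f) = blkV1 i.hN i.D f)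
include hβI

/-- ★ the carrier block is preserved: `β (πF c) = β c`. [cite: Balaban1984PropagatorsII, (2.45) p.231, bookkeeping] -/
theorem beta_repSite39F (c : IBondY i) : β i.hN i.D i.hk (repSite39F i bI c) = β i.hN i.D i.hk c := beta_rep39F_beta hβI c

/-- `πF` preserves the distance (it factors through `β`). [cite: Balaban1984PropagatorsII, (2.46) p.231, bookkeeping] -/
theorem dist_repSite39F (c c' : IBondY i) : (geo9K i).dist (repSite39F i bI c) (repSite39F i bI c') = (geo9K i).dist c c' := by
  show (B6Geom246MultiLevelTorus.geomT i.D).dist (β i.hN i.D i.hk _) (β i.hN i.D i.hk _) =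
    (B6Geom246MultiLevelTorus.geomT i.D).dist (β i.hN i.D i.hk _) (β i.hN i.D i.hk _)
  rw [beta_repSite39F hβI, beta_repSite39F hβI]

/-- `πF` on the left preserves the distance. [cite: Balaban1984PropagatorsII, (2.46) p.231, bookkeeping] -/
theorem dist_repSite39F_left (c z : IBondY i) : (geo9K i).dist (repSite39F i bI c) z = (geo9K i).dist c z := by
  show (B6Geom246MultiLevelTorus.geomT i.D).dist (β i.hN i.D i.hk _) (β i.hN i.D i.hk _) =
    (B6Geom246MultiLevelTorus.geomT i.D).dist (β i.hN i.D i.hk _) (β i.hN i.D i.hk _)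
  rw [beta_repSite39F hβI]

/-- `πF` on the right preserves the distance. [cite: Balaban1984PropagatorsII, (2.46) p.231, bookkeeping] -/
theorem dist_repSite39F_right (z c : IBondY i) : (geo9K i).dist z (repSite39F i bI c) = (geo9K i).dist z c := by
  show (B6Geom246MultiLevelTorus.geomT i.D).dist (β i.hN i.D i.hk _) (β i.hN i.D i.hk _) =
    (B6Geom246MultiLevelTorus.geomT i.D).dist (β i.hN i.D i.hk _) (β i.hN i.D i.hk _)
  rw [beta_repSite39F hβI]

/-- `πF` preserves the level. [cite: Balaban1985BackgroundPropagators, (3.41) p.397, bookkeeping] -/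
theorem lvl_repSite39F (c : IBondY i) : lvl i.hN i.D i.hk (repSite39F i bI c) = lvl i.hN i.D i.hk c := by
  have hk1 : 1 ≤ i.k := le_trans (by norm_num) i.hk2
  rw [← beta_level i.hN i.D i.hk hk1, ← beta_level i.hN i.D i.hk hk1, beta_repSite39F hβI]

/-- `πF` preserves the length `Lʲη`. [cite: Balaban1985BackgroundPropagators, (3.41) p.397, bookkeeping] -/
theorem len_repSite39F (c : IBondY i) : (geo9K i).len (repSite39F i bI c) = (geo9K i).len c := by
  rw [geo9K_len_kGeo, geo9K_len_kGeo, B6KLevelCensusIndexV1.len_eq, B6KLevelCensusIndexV1.len_eq, lvl_repSite39F hβI]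

/-- `πF` preserves the pairing weight `(L^{j′}η)^d`. [cite: Balaban1985BackgroundPropagators, (3.48) p.398, bookkeeping] -/
theorem vol_repSite39F (dd : ℕ) (c : IBondY i) : vol (geo9K i) dd (repSite39F i bI c) = vol (geo9K i) dd c := by
  unfold vol
  rw [len_repSite39F hβI]

omit hβI in
omit [CompleteSpace 𝔸] in
/-- the faithful block map on a coordinate of a carrier block: `blk39F (β c, k) = πF c` (by `rfl`). [cite: Balaban1984PropagatorsII, (2.45) p.231, bookkeeping] -/
theorem blk39F_beta [FiniteDimensional ℂ 𝔸] (c : IBondY i) (k : κ39 𝔸) : blk39F 𝔸 i bI (β i.hN i.D i.hk c, k) = repSite39F i bI c := rfl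

end Rep

/-! ## §2 The (3.48) reading through the faithful representative, for every letters family -/

section Reading

open B9PinCarriersKLevelV1

variable [FiniteDimensional ℂ 𝔸] {G : Subgroup 𝔸ˣ} {ι κ' : Type}
variable [∀ x : MemberY d ℓ hd hL b₀ b₁ Mstar, DecidableEq (geo9Y x).Site]

omit [NormedAlgebra ℂ 𝔸] [CompleteSpace 𝔸] [FiniteDimensional ℂ 𝔸] [∀ x : MemberY d ℓ hd hL b₀ b₁ Mstar, DecidableEq (geo9Y x).Site] in
/-- an entry is at most the block norm of the fibres of its indices. [cite: Balaban1984PropagatorsII, (2.51) p.232, bookkeeping] -/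
theorem abs_entry_le_blockKer {g : B9.Geometry} [DecidableEq g.Site] {X : Type} [Fintype X] [DecidableEq X] (blk : X → g.Site) (T : Module.End ℝ (X → ℝ)) (p p' : X) :
    |entry T p p'| ≤ blockKer blk T (blk p) (blk p') := by
  have h1 : |entry T p p'| ≤ ∑ x' ∈ univ.filter (fun x' => blk x' = blk p'), |entry T p x'| :=
    Finset.single_le_sum (f := fun x' => |entry T p x'|) (fun _ _ => abs_nonneg _) (Finset.mem_filter.2 ⟨Finset.mem_univ _, rfl⟩)
  exact h1.trans (le_ciSup (f := fun xx : {xx : X // blk xx = blk p} => ∑ x' ∈ univ.filter (fun x' => blk x' = blk p'), |entry T xx.1 x'|)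
    (Set.finite_range _).bddAbove ⟨p, rfl⟩)

/-- ★★ **n06-j's `reading_le_of_letters` FOR THE FAITHFUL BLOCK MAP**: for letters `𝔏` with `𝔏.C = CY … 𝔏.parS 𝔏.Gp`, carrier letters `𝔬` over `X39` with
`𝔬.blk = blk39F bI` and `𝔬.L = L39 𝔏.parS 𝔏.Gp`, at every `U` where `𝔬.L U` has a two-sided inverse `T`:
`|Cinv.ker U y y′| ≤ (cR39·|κ39|)·((L^{j(y′)}η)^{d+1})⁻¹·blockKer 𝔬.blk T (πF y) (πF y′)` (through n06-i's arbitrary-block dictionary).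
[cite: Balaban1985BackgroundPropagators, Thm 3.2 (3.48) p.398 + (3.25) p.395 + (3.96) p.411; Balaban1984PropagatorsII, (2.51) p.232 + p.248] -/
theorem reading_le_of_letters_F (x : MemberY d ℓ hd hL b₀ b₁ Mstar) (𝔏 : CovLettersY 𝔸 x) (𝔈 : ExpLettersY 𝔸 G x)
    (hC : 𝔏.C = CY x.toKIdx 𝔏.parS 𝔏.Gp) {bI : FBondY x.toKIdx → IBondY x.toKIdx}
    (𝔬 : Ops39Blk (geo9Y x) (bg9Y 𝔸 G x) (X39 𝔸 x.toKIdx) ι κ')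
    (hblk : 𝔬.blk = blk39F 𝔸 x.toKIdx bI) (hL39 : 𝔬.L = L39 x.toKIdx 𝔏.parS 𝔏.Gp)
    (U : (bg9Y 𝔸 G x).Cfg) (T : Module.End ℝ (X39 𝔸 x.toKIdx → ℝ)) (hTL : T * 𝔬.L U = 1) (hLT : 𝔬.L U * T = 1)
    (y y' : (geo9Y x).Site) :
    |(operatorLayerYOfLetters 𝔸 G x 𝔏 𝔈).Cinv.ker U y y'| ≤
      (cR39 (basis39 𝔸) * Fintype.card (κ39 𝔸)) * (vol (geo9Y x) (d + 1) y')⁻¹ *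
        blockKer 𝔬.blk T (repSite39F x.toKIdx bI y) (repSite39F x.toKIdx bI y') := by
  rw [hL39] at hTL hLT
  have hK : ∀ (s : BlkY x.toKIdx) (c : κ39 𝔸) (s' : BlkY x.toKIdx) (c' : κ39 𝔸),
      |entry T (s, c) (s', c')| ≤ blockKer 𝔬.blk T (rep39F x.toKIdx bI s) (rep39F x.toKIdx bI s') := by
    intro s c s' c'
    have h := abs_entry_le_blockKer 𝔬.blk T (s, c) (s', c')
    rw [hblk] at h ⊢
    exact h
  have hvol : (lenB x.toKIdx (β x.hN x.D x.hk y') ^ (d + 1))⁻¹ = (vol (geo9Y x) (d + 1) y')⁻¹ := by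
    unfold vol
    rw [geo9Y_len_eq_lenB, Real.rpow_natCast]
  have hbk : 0 ≤ blockKer 𝔬.blk T (repSite39F x.toKIdx bI y) (repSite39F x.toKIdx bI y') := blockKer_nonneg _ _ _ _
  have hpt : ∀ E : BallY 𝔸, ‖𝔏.C U (deltaY (β x.hN x.D x.hk y') (E : 𝔸)) (β x.hN x.D x.hk y)‖ ≤
      (cR39 (basis39 𝔸) * Fintype.card (κ39 𝔸)) * (vol (geo9Y x) (d + 1) y')⁻¹ *
        blockKer 𝔬.blk T (repSite39F x.toKIdx bI y) (repSite39F x.toKIdx bI y') := by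
    intro E
    have hE : ‖(E : 𝔸)‖ ≤ 1 := mem_closedBall_zero_iff.1 E.2
    have h := norm_CY_deltaY_le_of_inverse x 𝔏.parS 𝔏.Gp U T hTL hLT (rep39F x.toKIdx bI) (K := fun a a' => blockKer 𝔬.blk T a a') hK
      (β x.hN x.D x.hk y) (β x.hN x.D x.hk y') hE
    rw [hC, ← hvol]
    calc ‖CY x.toKIdx 𝔏.parS 𝔏.Gp U (deltaY (β x.hN x.D x.hk y') (E : 𝔸)) (β x.hN x.D x.hk y)‖
        ≤ (lenB x.toKIdx (β x.hN x.D x.hk y') ^ (d + 1))⁻¹ * (cR39 (basis39 𝔸) * Fintype.card (κ39 𝔸)) *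
            blockKer 𝔬.blk T (rep39F x.toKIdx bI (β x.hN x.D x.hk y)) (rep39F x.toKIdx bI (β x.hN x.D x.hk y')) := h
      _ = (cR39 (basis39 𝔸) * Fintype.card (κ39 𝔸)) * (lenB x.toKIdx (β x.hN x.D x.hk y') ^ (d + 1))⁻¹ *
            blockKer 𝔬.blk T (repSite39F x.toKIdx bI y) (repSite39F x.toKIdx bI y') := by rw [repSite39F, repSite39F]; ring
  haveI : Nonempty (BallY 𝔸) := ballY_nonempty
  have hker : (operatorLayerYOfLetters 𝔸 G x 𝔏 𝔈).Cinv.ker U y y' =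
      ⨆ E : BallY 𝔸, ‖𝔏.C U (deltaY (β x.hN x.D x.hk y') (E : 𝔸)) (β x.hN x.D x.hk y)‖ := rfl
  rw [hker, abs_of_nonneg (Real.iSup_nonneg fun E => norm_nonneg _)]
  exact ciSup_le hpt

end Reading

/-! ## §3 At the record's carriers: the reading DISCHARGED for the faithful pins; rows 15 ∧ 16 with the faithful pins -/

section StageY

open scoped Matrix.Norms.L2Operator
open B9PinMembersKLevelV1 B9PinCarriersKLevelV1 B9PinGeometryKLevelV1 B7Prop2SpecialUnitary

variable {N : ℕ} (θ : Stage3Params) (Mstar : ℕ) (𝔏 : LettersY N θ Mstar) (𝔈 : ExpsY N θ Mstar)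
variable [∀ x : MemberY θ.d₆ θ.ℓ₆ θ.hd' θ.hL' θ.b₀ θ.b₁ Mstar, Fintype (geo9Y x).Site]
  [∀ x : MemberY θ.d₆ θ.ℓ₆ θ.hd' θ.hL' θ.b₀ θ.b₁ Mstar, DecidableEq (geo9Y x).Site]
variable {ι κ : MemberY θ.d₆ θ.ℓ₆ θ.hd' θ.hL' θ.b₀ θ.b₁ Mstar → Type} [∀ x, Fintype (ι x)]
variable {bI : ∀ x : MemberY θ.d₆ θ.ℓ₆ θ.hd' θ.hL' θ.b₀ θ.b₁ Mstar, FBondY x.toKIdx → IBondY x.toKIdx}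

omit [∀ x : MemberY θ.d₆ θ.ℓ₆ θ.hd' θ.hL' θ.b₀ θ.b₁ Mstar, Fintype (geo9Y x).Site] [∀ x, Fintype (ι x)] in
/-- ★ **`KerReadsLeVia` DISCHARGED AT `opsYOfLetters N θ M⋆ 𝔏 𝔈` FOR THE FAITHFUL PINS** (`(𝔬39 x).blk = blk39F … (bI x)`, `(𝔬39 x).L = L39 …`), representative
map `repSite39F x.toKIdx (bI x)`, constant `cR39 (basis39 M_N(ℂ)) · |κ39 M_N(ℂ)|`. [cite: Balaban1985BackgroundPropagators, Thm 3.2 (3.48) p.398 + (3.96) p.411; Balaban1984PropagatorsII, (2.51) p.232 + p.248] -/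
theorem kerReadsLeVia_opsYOfLetters_F
    (hC : ∀ x : MemberY θ.d₆ θ.ℓ₆ θ.hd' θ.hL' θ.b₀ θ.b₁ Mstar, (𝔏 x).C = CY x.toKIdx (𝔏 x).parS (𝔏 x).Gp)
    (𝔬39 : ∀ x : MemberY θ.d₆ θ.ℓ₆ θ.hd' θ.hL' θ.b₀ θ.b₁ Mstar,
      Ops39Blk (geo9Y x) (bg9Y (Matrix (Fin N) (Fin N) ℂ) (specialUnitaryUnits (Fin N)) x) (X39 (Matrix (Fin N) (Fin N) ℂ) x.toKIdx) (ι x) (κ x))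
    (hblk : ∀ x, (𝔬39 x).blk = blk39F (Matrix (Fin N) (Fin N) ℂ) x.toKIdx (bI x))
    (hL39 : ∀ x, (𝔬39 x).L = L39 x.toKIdx (𝔏 x).parS (𝔏 x).Gp) (x : MemberY θ.d₆ θ.ℓ₆ θ.hd' θ.hL' θ.b₀ θ.b₁ Mstar) :
    KerReadsLeVia (𝔬39 x) ((opsYOfLetters N θ Mstar 𝔏 𝔈) x).Cinv (θ.d₆ + 1)
      (cR39 (basis39 (Matrix (Fin N) (Fin N) ℂ)) * Fintype.card (κ39 (Matrix (Fin N) (Fin N) ℂ))) (repSite39F x.toKIdx (bI x)) :=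
  fun U T hTL hLT y y' => reading_le_of_letters_F x (𝔏 x) (𝔈 x) (hC x) (𝔬39 x) (hblk x) (hL39 x) U T hTL hLT y y'

/-- ★★ **ROWS 15 ∧ 16 OF THE N06 KNIT AT def-Y's INSTANCE FROM THE FAITHFUL PINS** — n06-j's `t39_hksum_of_pins_opsYOfLetters` with `blk39 ↦ blk39F (bI x)`,
`repSite39 ↦ repSite39F x.toKIdx (bI x)` and ONE more displayed geometric binder `hβI` (carrier-faithfulness of `bI`, already displayed by the knit): from
the schemas, the pins `hblk`, `hL39`, `hEK39` and `hC`, `B9.Thm39Printed … (ops x).EK39 ∧ B9.RWKernelSumYields …` at `ops := opsYOfLetters N θ M⋆ 𝔏 𝔈`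
(n06-j's generic `t39_hksum_of_pin_rowConst261BlkViaDatum`; the representatives' invariances by `len_repSite39F` ∕ `dist_repSite39F_left` ∕ `_right`).
With THESE pins the same letters `𝔬39` feed row 25's `B9Ineq349SiteFromConv348.majorants348_of_thm39Printed`.
[cite: Balaban1985BackgroundPropagators, Thm 3.9 (3.98)–(3.99) p.413 + Thm 3.2 (3.48) p.398 + (3.25) p.395; Balaban1984PropagatorsII, Lemma 2.1 (2.61) p.234 + (2.51) p.232 + p.248] -/
theorem t39_hksum_of_pins_opsYOfLetters_F
    (𝔬39 : ∀ x : MemberY θ.d₆ θ.ℓ₆ θ.hd' θ.hL' θ.b₀ θ.b₁ Mstar,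
      Ops39Blk (geo9Y x) (bg9Y (Matrix (Fin N) (Fin N) ℂ) (specialUnitaryUnits (Fin N)) x) (X39 (Matrix (Fin N) (Fin N) ℂ) x.toKIdx) (ι x) (κ x))
    (rd39 : ∀ x : MemberY θ.d₆ θ.ℓ₆ θ.hd' θ.hL' θ.b₀ θ.b₁ Mstar,
      WalkReading39 (bg9Y (Matrix (Fin N) (Fin N) ℂ) (specialUnitaryUnits (Fin N)) x) (ι x) (κ x))
    (α α' r δ₀ θ₀ B₀ N₀ a₁ M₁ : ℝ)
    (hα : 0 < α) (hα1 : α < 1) (hα'0 : 0 < α') (hα'1 : α' < 1) (hr : 0 < r) (hrδ : r ≤ δ₀) (hθ₀ : 0 ≤ θ₀) (hB₀ : 0 < B₀)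
    (hN₀ : 0 ≤ N₀) (ha₁ : 0 < a₁) (hM₁ : 0 < M₁)
    (hst : ∀ x, StaticOK39Blk (𝔬39 x) N₀) (hloc : ∀ x, Locality39Blk (𝔬39 x) (rd39 x))
    (h39 : ∀ x : MemberY θ.d₆ θ.ℓ₆ θ.hd' θ.hL' θ.b₀ θ.b₁ Mstar, M₁ ≤ (geo9Y x).M → ∀ α₀ : ℝ, 0 < α₀ → c35Y * (geo9Y x).M * α₀ ≤ a₁ →
      ∀ U : (bg9Y (Matrix (Fin N) (Fin N) ℂ) (specialUnitaryUnits (Fin N)) x).Cfg,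
        (bg9Y (Matrix (Fin N) (Fin N) ℂ) (specialUnitaryUnits (Fin N)) x).Reg335 c35Y α₀ U →
        Local348Blk (𝔬39 x) B₀ δ₀ U ∧ Identities395Blk (𝔬39 x) U ∧ Small285Blk (𝔬39 x) θ₀ r U ∧ Factors389Blk (𝔬39 x) θ₀ δ₀ U)
    (hC : ∀ x : MemberY θ.d₆ θ.ℓ₆ θ.hd' θ.hL' θ.b₀ θ.b₁ Mstar, (𝔏 x).C = CY x.toKIdx (𝔏 x).parS (𝔏 x).Gp)
    (hβI : ∀ (x : MemberY θ.d₆ θ.ℓ₆ θ.hd' θ.hL' θ.b₀ θ.b₁ Mstar) (f : FBondY x.toKIdx) (c : IBondY x.toKIdx),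
      blkV1 x.hN x.D f = β x.hN x.D x.hk c → β x.hN x.D x.hk (bI x f) = blkV1 x.hN x.D f)
    (hblk : ∀ x, (𝔬39 x).blk = blk39F (Matrix (Fin N) (Fin N) ℂ) x.toKIdx (bI x))
    (hL39 : ∀ x, (𝔬39 x).L = L39 x.toKIdx (𝔏 x).parS (𝔏 x).Gp)
    (hEK39 : ∀ x : MemberY θ.d₆ θ.ℓ₆ θ.hd' θ.hL' θ.b₀ θ.b₁ Mstar, ((opsYOfLetters N θ Mstar 𝔏 𝔈) x).EK39 =
      EK39OfOpsBlkVia (𝔬39 x) (rd39 x) (θ.d₆ + 1)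
        (2 * (N₀ * B₀) * B9RowSum261DefiniteFaces.rowConst261 (geo9Y (d := θ.d₆) (ℓ := θ.ℓ₆) (hd := θ.hd') (hL := θ.hL')
          (b₀ := θ.b₀) (b₁ := θ.b₁) (Mstar := Mstar)) (α' * r)) ((1 - α') * r) (repSite39F x.toKIdx (bI x))) :
    B9.Thm39Printed (θ.d₆ + 1) c35Y geo9Y (bg9Y (Matrix (Fin N) (Fin N) ℂ) (specialUnitaryUnits (Fin N)))
        (fun x => ((opsYOfLetters N θ Mstar 𝔏 𝔈) x).EK39) ∧
      B9.RWKernelSumYields (θ.d₆ + 1) geo9Y (bg9Y (Matrix (Fin N) (Fin N) ℂ) (specialUnitaryUnits (Fin N)))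
        (fun x => ((opsYOfLetters N θ Mstar 𝔏 𝔈) x).EK39) (fun x => ((opsYOfLetters N θ Mstar 𝔏 𝔈) x).Cinv) :=
  t39_hksum_of_pin_rowConst261BlkViaDatum (opsYOfLetters N θ Mstar 𝔏 𝔈) 𝔬39 rd39 (fun x => repSite39F x.toKIdx (bI x)) (θ.d₆ + 1) α α' r δ₀ θ₀
    B₀ N₀ a₁ M₁ (cR39 (basis39 (Matrix (Fin N) (Fin N) ℂ)) * Fintype.card (κ39 (Matrix (Fin N) (Fin N) ℂ))) c35Y_pos hα hα1 hα'0 hα'1 hr hrδ hθ₀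
    hB₀ hN₀ ha₁ hM₁ (mul_nonneg (cR39_nonneg _) (Nat.cast_nonneg _)) hst hloc
    (fun x y => len_repSite39F (hβI x) y) (fun x y z => dist_repSite39F_left (hβI x) y z) (fun x z y => dist_repSite39F_right (hβI x) z y)
    h39 hEK39 (kerReadsLeVia_opsYOfLetters_F θ Mstar 𝔏 𝔈 hC 𝔬39 hblk hL39)

end StageY

end Literature.MathematicalPhysics.QuantumFieldTheory.Balaban1983to89.B9Thm39ReadingFaithful

end
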